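import Summits.BirchSwinnertonDyer.BirchSwinnertonDyer.Theorems.SignedLowerHalvesSprungLowerDivisibilityAtThreeIotaDoorContraOrbitTelescope
import Summits.BirchSwinnertonDyer.BirchSwinnertonDyer.Theorems.SignedLowerHalvesSprungLowerDivisibilityAtThreeIotaDoorContraOrbitKato
import Summits.BirchSwinnertonDyer.BirchSwinnertonDyer.Theorems.SignedLowerHalvesSprungLowerDivisibilityAtThreeIotaDoorContraOrbitExcess
import Summits.BirchSwinnertonDyer.BirchSwinnertonDyer.Theorems.SignedLowerHalvesSprungLowerDivisibilityAtThreeIotaDoorContraClosedOfPTMatar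
import HarnessLib

/-!
# Crux `SprungLowerDivisibilityAtThree` (item stmt-BirchSwinnertonDyer-19875; twin route `PrintX8VSC`: crux K′ 23732), line `chromatic-common-zeros`:
# THE ORBIT FORM, part 6 — the K′-telescope theorems of parts 3–5 on the TWO-FACT trust base {Poitou–Tate functional model, Matar 2020 Thm. 1.1}
# + Sprung Thm. 7.14 (+ the period unit at 3), i.e. WITHOUT Kato's Thm. 12.4, matching the RE-REGISTERED twin skeletons v4 (LEAD g10)

Cell `bsd-ssimc` (host), width seat `cruxlead-stmt-BirchSwinnertonDyer-19875-w2` (gen 12) under the 19875 LEAD; `--supports`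
stmt-BirchSwinnertonDyer-19875 `--as helper`; theorems only (no `def`, no named fact, no instance); closes NO item. WHY THIS FILE: LEAD g9 landed the
Kato-12.4-free doors (`iotaDoorContra_sporadic_of_poitouTate_of_matar_of_thm714`, p678813, on w3 g10's `cokerBoundIotaOffT_contra_of_poitouTate_of_thm714'`,
p677954) and LEAD g10 re-registered the K′ skeleton v4 with THIS seat's orbit residue (`PrintX8VSCIotaDoorContra.katoFineLowerSporadicGivenHeldX8Contra_iff_orbitResidue`,
p679566) as the one stub and the 2-fact door; parts 3–5 of the orbit form (`…OrbitTelescope` p679563, `…OrbitKato` p679886, `…OrbitExcess` p680476)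
were instantiated on the 4-fact born pack. Here are the same four K′-telescope statements on the 2-fact door — one-line delegations / verbatim
re-threadings; the Kato-12.4 binder `h124` disappears from every signature.

Notation (print keying, K′ binders of item 23732: X8 pair, cyclotomic/Honda setting, newform `f`, period ratio `ϖ`, Sprung pair, Kato datum `I`, joint
contragredient packages `Cs, Cf` with `Cs.Z = Cf.Z`, natural-keyed `Y′`, sporadic height-one `𝔭 ∌ p`): `k = ℓ_𝔭(I.H ⧸ Cs.Z)`, `j = min_• ℓ_𝔭(Λ ⧸ range C•.colMap)`,
`m = min(ℓ_𝔭 Λ/(Gs), ℓ_𝔭 Λ/(Gf))`, `x′ = ℓ_𝔭 Y′.X`, `k′ = k(ι𝔭)`, `j′ = j(ι𝔭)`.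

* `katoFineLowerSporadic_contra_of_mirrorDoor_of_poitouTate_of_matar_of_thm714 (hPT) (hMatar) (h714) (h3)`: door AT THE MIRROR `k′ ≤ j` ⟹ `k ≤ x′`.
* `katoFineLowerSporadic_contra_of_zeta_comap_invol_eq_zero_of_poitouTate_of_matar_of_thm714 (hPT) (hMatar) (h714) (h3)`: `k′ = 0` ⟹ `k ≤ x′`.
* `zeta_eq_fine_sporadic_contra_of_iotaDoor_of_poitouTate_of_matar_of_thm714 (hPT) (hMatar) (h714) (h3) (h134C) (hSerre)`: INSIDE the door
  (`k ≤ j′`), **`k = x′`** — Kato's Main Conjecture 12.10 with both inclusions at `𝔭`, modulo six displayed prints.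
* `min_lengthAt_quotient_span_le_fine_add_zeta_comap_invol_sporadic_contra_of_poitouTate_of_matar_of_thm714 (hPT) (hMatar) (h714)`: at EVERY sporadic
  `𝔭` (no common-zero hypothesis), for any Néron-normalised `Gs, Gf`: **`m ≤ x′ + k′`** (F-α♮′ in its cleanest reading).

HONEST FRAMING: bookkeeping over landed theorems; nothing is discharged; PT functional model, Matar 1.1, Sprung Thm. 7.14, the period unit, Kato 13.4
and Serre's open image are printed theorems typed statement-only; the registered residue `stub_iotaOrbitResidueContra` (v4), K′, C′, K1, leaf X8 and
BSD are NOT proved.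

References: [Kato2004Asterisque] Conj. 12.10 (p. 224), Thm. 12.6 (p. 222), Thm. 13.4 (p. 226), (17.13.1) (pp. 279–280); [Sprung2012] Def. 6.1, §7.1
Props. 7.3/7.6, Thm. 7.14 (3) (p. 1504), Main Conj. 7.21 (p. 1505); [Sprung2017] Thm. 4.13, Cor. 4.14; [Matar2020] Thm. 1.1; [Wingberg1989] Cor. 2.5;
[Kobayashi2003] Prop. 7.1, Thm. 7.3; [GreenbergVatsal2000] §3 Rem. 3.4; [SerreAbelianLadic1968] IV-11; tree: `…IotaDoorContraClosedOfPTMatar` (LEAD g9),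
`…CokerBoundByMassPoitouTateOfColMap` (w3 g10), `…IotaDoorContraOrbit{,Fine,Telescope,Kato,Excess}` (w2 g12).
-/

set_option linter.dupNamespace false
set_option autoImplicit false

noncomputable section

open scoped Classical NumberField MatrixGroups ModularForm

open NumberField IsDedekindDomain CongruenceSubgroup WeierstrassCurve Field
  Literature.NumberTheory.EllipticCurves Literature.NumberTheory.EllipticCurves.ModularForms
  Literature.NumberTheory.EllipticCurves.ZpExtension Literature.NumberTheory.EllipticCurves.Sprung2017
  Literature.NumberTheory.EllipticCurves.Sprung2012 Literature.NumberTheory.EllipticCurves.Rank1Residual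
  Literature.NumberTheory.EllipticCurves.IwasawaAlgebra Literature.NumberTheory.EllipticCurves.Kato2004
  Literature.NumberTheory.EllipticCurves.Module
  Summit.BirchSwinnertonDyer.BirchSwinnertonDyer.Theorems
  Summit.BirchSwinnertonDyer.Rank1Residual.Supersingular

namespace Summit.BirchSwinnertonDyer.BirchSwinnertonDyer.Theorems.ChromaticCommonZeros

/-- `G ≠ 0` for a Néron-normalised `G` of a non-zero `L` with `ϖ ≠ 0` (private plumbing). [cite: Sprung2012, Def. 6.1 (p. 1495)] -/
private theorem normalised_ne_zero_orbitPTMatar {p : ℕ} [Fact p.Prime] {ϖ : ℚ} (hϖ0 : ϖ ≠ 0) {L G : IwasawaAlgebra p} (hL : L ≠ 0)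
    (hG : iwasawaToPowerSeries p G = PowerSeries.C ((ϖ : ℚ) : ℚ_[p]) * iwasawaToPowerSeries p L) : G ≠ 0 := by
  intro h0
  rw [h0, map_zero, eq_comm, mul_eq_zero] at hG
  rcases hG with hC | hL'
  · have h1 : ((ϖ : ℚ) : ℚ_[p]) = 0 := by simpa using congrArg PowerSeries.constantCoeff hC
    exact hϖ0 (by exact_mod_cast h1)
  · exact hL (iwasawaToPowerSeries_injective p (by rw [hL', map_zero]))

/-- **Door at the mirror ⟹ K at `𝔭`, on the 2-fact door** (`hdoor := iotaDoorContra_sporadic_of_poitouTate_of_matar_of_thm714 hPT hMatar h714`,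
LEAD g9; period unit `h3`). [cite: Kato2004Asterisque, Conj. 12.10 (p. 224), (17.13.1) (pp. 279–280)] [cite: Sprung2012, Thm. 7.14 (3) (p. 1504)]
[cite: Matar2020, Thm. 1.1] [cite: GreenbergVatsal2000, §3, Remark 3.4] -/
theorem katoFineLowerSporadic_contra_of_mirrorDoor_of_poitouTate_of_matar_of_thm714
    (hPT : thm714seq_sharpFlat_poitouTate_functionalModel) (hMatar : matar2020_thm11_selmerDualTorsion_pseudoIso_fineSelmerDual)
    (h714 : thm714_sharpFlatSelmerDual_finite_torsion) (h3 : realPeriodRat_eq_unit_mul_plusPeriod_three) :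
    ∀ (W : WeierstrassCurve ℚ) [W.IsElliptic] [W.IsGloballyMinimal] (p : ℕ) [Fact p.Prime]
      [ContinuousSMul ℤ_[p] (W.tateModule p)] [Module.Free ℤ_[p] (W.tateModule p)]
      [Module.Finite ℤ_[p] (W.tateModule p)],
      ClassX8 W p → ∀ (κ : ZpExtension ℚ p) (γ : Field.absoluteGaloisGroup ℚ),
      κ.IsCyclotomic → κ.IsTopGenerator γ → IsCyclotomicVariable p γ →
    ∀ (v : HeightOneSpectrum (𝓞 ℚ)), (p : 𝓞 ℚ) ∈ v.asIdeal →
    ∀ (g : Field.absoluteGaloisGroup (v.adicCompletion ℚ)),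
      κ.IsTopGenerator (resGalOfEmb (closureEmb (K := ℚ) (v.adicCompletion ℚ)) g) →
    ∀ (cneg : localPoints W (v.adicCompletion ℚ)) (c : ℕ → localPoints W (v.adicCompletion ℚ)),
      IsHondaSystem κ (closureEmb (K := ℚ) (v.adicCompletion ℚ)) W (W.frobeniusTrace p) g cneg c →
    ∀ (N : ℕ) (_ : NeZero N) (f : CuspForm (Gamma0 N) 2) (ϖ : ℚ) (Lsharp Lflat : IwasawaAlgebra p),
      IsNewformOf W f → (ϖ : ℝ) * W.realPeriodRat = plusPeriod f →
      IsSprungPair f p (W.frobeniusTrace p) Lsharp Lflat →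
    ∀ (I : Kato2004.IwasawaH1Data W p κ γ)
      (Cs : SharpFlatColemanKatoDataContra W p f ϖ κ γ (closureEmb (K := ℚ) (v.adicCompletion ℚ))
        (W.frobeniusTrace p) g c Chroma.sharp I)
      (Cf : SharpFlatColemanKatoDataContra W p f ϖ κ γ (closureEmb (K := ℚ) (v.adicCompletion ℚ))
        (W.frobeniusTrace p) g c Chroma.flat I),
      Cs.Z = Cf.Z →
    ∀ (Y : W.FineSelmerDualData κ γ⁻¹) (𝔭 : PrimeSpectrum (IwasawaAlgebra p)), 𝔭.asIdeal.height = 1 →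
      (p : IwasawaAlgebra p) ∉ 𝔭.asIdeal →
      (¬ ∃ n : ℕ, ((cyclotomicOmega p n).map (Int.castRingHom ℤ_[p]) : PowerSeries ℤ_[p]) ∈ 𝔭.asIdeal) →
      (∀ (col' : Chroma) (G' : IwasawaAlgebra p),
        iwasawaToPowerSeries p G' =
          PowerSeries.C (ϖ : ℚ_[p]) * iwasawaToPowerSeries p (chromaticL col' Lsharp Lflat) →
        G' ∈ 𝔭.asIdeal) →
      Module.lengthAt (IwasawaAlgebra p) (I.H ⧸ Cs.Z) (PrimeSpectrum.comap (invol p).toRingHom 𝔭) ≤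
          min (Module.lengthAt (IwasawaAlgebra p) (IwasawaAlgebra p ⧸ LinearMap.range Cs.colMap) 𝔭)
            (Module.lengthAt (IwasawaAlgebra p) (IwasawaAlgebra p ⧸ LinearMap.range Cf.colMap) 𝔭) →
      Module.lengthAt (IwasawaAlgebra p) (I.H ⧸ Cs.Z) 𝔭 ≤ Module.lengthAt (IwasawaAlgebra p) Y.X 𝔭 :=
  katoFineLowerSporadic_contra_of_mirrorDoor h3 (iotaDoorContra_sporadic_of_poitouTate_of_matar_of_thm714 hPT hMatar h714)

/-- **A mirror without zeta index ⟹ K at `𝔭`, on the 2-fact door** (`hdoor := iotaDoorContra_sporadic_of_poitouTate_of_matar_of_thm714 …`,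
period unit `h3`). [cite: Kato2004Asterisque, Conj. 12.10 (p. 224), (17.13.1) (pp. 279–280)] [cite: Sprung2012, Thm. 7.14 (3) (p. 1504)]
[cite: Matar2020, Thm. 1.1] [cite: GreenbergVatsal2000, §3, Remark 3.4] -/
theorem katoFineLowerSporadic_contra_of_zeta_comap_invol_eq_zero_of_poitouTate_of_matar_of_thm714
    (hPT : thm714seq_sharpFlat_poitouTate_functionalModel) (hMatar : matar2020_thm11_selmerDualTorsion_pseudoIso_fineSelmerDual)
    (h714 : thm714_sharpFlatSelmerDual_finite_torsion) (h3 : realPeriodRat_eq_unit_mul_plusPeriod_three) :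
    ∀ (W : WeierstrassCurve ℚ) [W.IsElliptic] [W.IsGloballyMinimal] (p : ℕ) [Fact p.Prime]
      [ContinuousSMul ℤ_[p] (W.tateModule p)] [Module.Free ℤ_[p] (W.tateModule p)]
      [Module.Finite ℤ_[p] (W.tateModule p)],
      ClassX8 W p → ∀ (κ : ZpExtension ℚ p) (γ : Field.absoluteGaloisGroup ℚ),
      κ.IsCyclotomic → κ.IsTopGenerator γ → IsCyclotomicVariable p γ →
    ∀ (v : HeightOneSpectrum (𝓞 ℚ)), (p : 𝓞 ℚ) ∈ v.asIdeal →
    ∀ (g : Field.absoluteGaloisGroup (v.adicCompletion ℚ)),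
      κ.IsTopGenerator (resGalOfEmb (closureEmb (K := ℚ) (v.adicCompletion ℚ)) g) →
    ∀ (cneg : localPoints W (v.adicCompletion ℚ)) (c : ℕ → localPoints W (v.adicCompletion ℚ)),
      IsHondaSystem κ (closureEmb (K := ℚ) (v.adicCompletion ℚ)) W (W.frobeniusTrace p) g cneg c →
    ∀ (N : ℕ) (_ : NeZero N) (f : CuspForm (Gamma0 N) 2) (ϖ : ℚ) (Lsharp Lflat : IwasawaAlgebra p),
      IsNewformOf W f → (ϖ : ℝ) * W.realPeriodRat = plusPeriod f →
      IsSprungPair f p (W.frobeniusTrace p) Lsharp Lflat →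
    ∀ (I : Kato2004.IwasawaH1Data W p κ γ)
      (Cs : SharpFlatColemanKatoDataContra W p f ϖ κ γ (closureEmb (K := ℚ) (v.adicCompletion ℚ))
        (W.frobeniusTrace p) g c Chroma.sharp I)
      (Cf : SharpFlatColemanKatoDataContra W p f ϖ κ γ (closureEmb (K := ℚ) (v.adicCompletion ℚ))
        (W.frobeniusTrace p) g c Chroma.flat I),
      Cs.Z = Cf.Z →
    ∀ (Y : W.FineSelmerDualData κ γ⁻¹) (𝔭 : PrimeSpectrum (IwasawaAlgebra p)), 𝔭.asIdeal.height = 1 →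
      (p : IwasawaAlgebra p) ∉ 𝔭.asIdeal →
      (¬ ∃ n : ℕ, ((cyclotomicOmega p n).map (Int.castRingHom ℤ_[p]) : PowerSeries ℤ_[p]) ∈ 𝔭.asIdeal) →
      (∀ (col' : Chroma) (G' : IwasawaAlgebra p),
        iwasawaToPowerSeries p G' =
          PowerSeries.C (ϖ : ℚ_[p]) * iwasawaToPowerSeries p (chromaticL col' Lsharp Lflat) →
        G' ∈ 𝔭.asIdeal) →
      Module.lengthAt (IwasawaAlgebra p) (I.H ⧸ Cs.Z) (PrimeSpectrum.comap (invol p).toRingHom 𝔭) = 0 →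
      Module.lengthAt (IwasawaAlgebra p) (I.H ⧸ Cs.Z) 𝔭 ≤ Module.lengthAt (IwasawaAlgebra p) Y.X 𝔭 :=
  katoFineLowerSporadic_contra_of_zeta_comap_invol_eq_zero h3 (iotaDoorContra_sporadic_of_poitouTate_of_matar_of_thm714 hPT hMatar h714)

/-- **INSIDE THE DOOR, `k(𝔭) = x′(𝔭)` on the 2-fact door** — Kato's Main Conjecture 12.10 with BOTH inclusions at a sporadic common zero `𝔭` of an
X8 pair with `k(𝔭) ≤ j(ι𝔭)`: door half `iotaDoorContra_sporadic_of_poitouTate_of_matar_of_thm714` (LEAD g9), Kato half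
`SharpFlatColemanKatoDataContra.fine_le_zeta_of_thm13_4` (`…OrbitKato`) with the X8 discharges (`p = 3 ≠ 2`, `ClassX8.not_hasCM`, `E[3]` irreducible,
a normalised generator from `stub_periodMu h3`). CONDITIONAL on the six displayed prints. [cite: Kato2004Asterisque, Conj. 12.10 (p. 224), Thm. 13.4 (p. 226), (17.13.1) (pp. 279–280)]
[cite: Sprung2012, Thm. 7.14 (3) (p. 1504), Main Conj. 7.21 (p. 1505)] [cite: Matar2020, Thm. 1.1] [cite: SerreAbelianLadic1968, Ch. IV §2.2 (IV-11)] -/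
theorem zeta_eq_fine_sporadic_contra_of_iotaDoor_of_poitouTate_of_matar_of_thm714
    (hPT : thm714seq_sharpFlat_poitouTate_functionalModel) (hMatar : matar2020_thm11_selmerDualTorsion_pseudoIso_fineSelmerDual)
    (h714 : thm714_sharpFlatSelmerDual_finite_torsion) (h3 : realPeriodRat_eq_unit_mul_plusPeriod_three)
    (h134C : thm13_4_lengthAt_fineSelmerDualContra_le_of_isEulerSystemClass)
    (hSerre : serre_adicImage_contains_congruenceSubgroup) :
    ∀ (W : WeierstrassCurve ℚ) [W.IsElliptic] [W.IsGloballyMinimal] (p : ℕ) [Fact p.Prime]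
      [ContinuousSMul ℤ_[p] (W.tateModule p)] [Module.Free ℤ_[p] (W.tateModule p)]
      [Module.Finite ℤ_[p] (W.tateModule p)],
      ClassX8 W p → ∀ (κ : ZpExtension ℚ p) (γ : Field.absoluteGaloisGroup ℚ),
      κ.IsCyclotomic → κ.IsTopGenerator γ → IsCyclotomicVariable p γ →
    ∀ (v : HeightOneSpectrum (𝓞 ℚ)), (p : 𝓞 ℚ) ∈ v.asIdeal →
    ∀ (g : Field.absoluteGaloisGroup (v.adicCompletion ℚ)),
      κ.IsTopGenerator (resGalOfEmb (closureEmb (K := ℚ) (v.adicCompletion ℚ)) g) →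
    ∀ (cneg : localPoints W (v.adicCompletion ℚ)) (c : ℕ → localPoints W (v.adicCompletion ℚ)),
      IsHondaSystem κ (closureEmb (K := ℚ) (v.adicCompletion ℚ)) W (W.frobeniusTrace p) g cneg c →
    ∀ (N : ℕ) (_ : NeZero N) (f : CuspForm (Gamma0 N) 2) (ϖ : ℚ) (Lsharp Lflat : IwasawaAlgebra p),
      IsNewformOf W f → (ϖ : ℝ) * W.realPeriodRat = plusPeriod f →
      IsSprungPair f p (W.frobeniusTrace p) Lsharp Lflat →
    ∀ (I : Kato2004.IwasawaH1Data W p κ γ)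
      (Cs : SharpFlatColemanKatoDataContra W p f ϖ κ γ (closureEmb (K := ℚ) (v.adicCompletion ℚ))
        (W.frobeniusTrace p) g c Chroma.sharp I)
      (Cf : SharpFlatColemanKatoDataContra W p f ϖ κ γ (closureEmb (K := ℚ) (v.adicCompletion ℚ))
        (W.frobeniusTrace p) g c Chroma.flat I),
      Cs.Z = Cf.Z →
    ∀ (Y : W.FineSelmerDualData κ γ⁻¹) (𝔭 : PrimeSpectrum (IwasawaAlgebra p)), 𝔭.asIdeal.height = 1 →
      (p : IwasawaAlgebra p) ∉ 𝔭.asIdeal →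
      (¬ ∃ n : ℕ, ((cyclotomicOmega p n).map (Int.castRingHom ℤ_[p]) : PowerSeries ℤ_[p]) ∈ 𝔭.asIdeal) →
      (∀ (col' : Chroma) (G' : IwasawaAlgebra p),
        iwasawaToPowerSeries p G' =
          PowerSeries.C (ϖ : ℚ_[p]) * iwasawaToPowerSeries p (chromaticL col' Lsharp Lflat) →
        G' ∈ 𝔭.asIdeal) →
      Module.lengthAt (IwasawaAlgebra p) (I.H ⧸ Cs.Z) 𝔭 ≤
          min (Module.lengthAt (IwasawaAlgebra p) (IwasawaAlgebra p ⧸ LinearMap.range Cs.colMap)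
                (PrimeSpectrum.comap (invol p).toRingHom 𝔭))
            (Module.lengthAt (IwasawaAlgebra p) (IwasawaAlgebra p ⧸ LinearMap.range Cf.colMap)
                (PrimeSpectrum.comap (invol p).toRingHom 𝔭)) →
      Module.lengthAt (IwasawaAlgebra p) (I.H ⧸ Cs.Z) 𝔭 = Module.lengthAt (IwasawaAlgebra p) Y.X 𝔭 := by
  intro W _ _ p _ _ _ _ hX κ γ hκ hγ hcv v hv g hg cneg c hH N hN f ϖ Lsharp Lflat hf hϖ hSP I Cs Cf hZ Y 𝔭 h𝔭 hp𝔭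
    hspor hcommon hdoor
  haveI : NeZero N := hN
  have hp2 : p ≠ 2 := by rw [hX.1]; decide
  have hs : chromaticL Chroma.sharp Lsharp Lflat ≠ 0 :=
    ChromaticBothColours.ClassX8.chromaticL_ne_zero W p hX f Lsharp Lflat hf hSP Chroma.sharp
  obtain ⟨hG, -⟩ := stub_periodMu h3 W p hX N hN f ϖ Lsharp Lflat hf hϖ hSP
  obtain ⟨Gs, hGs⟩ := hG Chroma.sharp
  have hGs0 : Gs ≠ 0 := normalised_ne_zero_orbitPTMatar (hf.periodRatio_ne_zero hϖ) hs hGs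
  refine le_antisymm
    (iotaDoorContra_sporadic_of_poitouTate_of_matar_of_thm714 hPT hMatar h714 W p hX κ γ hκ hγ hcv v hv g hg cneg c hH N hN f ϖ
      Lsharp Lflat hf hϖ hSP I Cs Cf hZ Y 𝔭 h𝔭 hp𝔭 hspor hcommon hdoor) ?_
  exact Cs.fine_le_zeta_of_thm13_4 W p h134C hSerre hp2 hκ hγ (ClassX8.not_hasCM W p hX) (ClassX8.irr' W p hX) hSP hs hGs
    hGs0 Y 𝔭 h𝔭 hp𝔭

/-- **`m(𝔭) ≤ x′(𝔭) + k(ι𝔭)` over the telescope WITHOUT its common-zero hypothesis, on the 2-fact F-α♮′** (w3 g10's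
`cokerBoundIotaOffT_contra_of_poitouTate_of_thm714'` at `ι𝔭`, read back through `ιι𝔭 = 𝔭`): at every sporadic `𝔭` of an X8 pair and for any
Néron-normalised `Gs, Gf`, the natural-keyed fine length is at least the common-zero multiplicity minus the MIRROR zeta index. CONDITIONAL on the
three displayed prints. [cite: Kato2004Asterisque, Conj. 12.10 (p. 224), (17.13.1) (pp. 279–280)] [cite: Sprung2012, Def. 6.1, Thm. 7.14 (3) (p. 1504)]
[cite: Matar2020, Thm. 1.1] [cite: Kobayashi2003, Prop. 7.1, Thm. 7.3 (pp. 12–13)] -/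
theorem min_lengthAt_quotient_span_le_fine_add_zeta_comap_invol_sporadic_contra_of_poitouTate_of_matar_of_thm714
    (hPT : thm714seq_sharpFlat_poitouTate_functionalModel) (hMatar : matar2020_thm11_selmerDualTorsion_pseudoIso_fineSelmerDual)
    (h714 : thm714_sharpFlatSelmerDual_finite_torsion) :
    ∀ (W : WeierstrassCurve ℚ) [W.IsElliptic] [W.IsGloballyMinimal] (p : ℕ) [Fact p.Prime]
      [ContinuousSMul ℤ_[p] (W.tateModule p)] [Module.Free ℤ_[p] (W.tateModule p)]
      [Module.Finite ℤ_[p] (W.tateModule p)],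
      ClassX8 W p → ∀ (κ : ZpExtension ℚ p) (γ : Field.absoluteGaloisGroup ℚ),
      κ.IsCyclotomic → κ.IsTopGenerator γ → IsCyclotomicVariable p γ →
    ∀ (v : HeightOneSpectrum (𝓞 ℚ)), (p : 𝓞 ℚ) ∈ v.asIdeal →
    ∀ (g : Field.absoluteGaloisGroup (v.adicCompletion ℚ)),
      κ.IsTopGenerator (resGalOfEmb (closureEmb (K := ℚ) (v.adicCompletion ℚ)) g) →
    ∀ (cneg : localPoints W (v.adicCompletion ℚ)) (c : ℕ → localPoints W (v.adicCompletion ℚ)),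
      IsHondaSystem κ (closureEmb (K := ℚ) (v.adicCompletion ℚ)) W (W.frobeniusTrace p) g cneg c →
    ∀ (N : ℕ) (_ : NeZero N) (f : CuspForm (Gamma0 N) 2) (ϖ : ℚ) (Lsharp Lflat : IwasawaAlgebra p),
      IsNewformOf W f → (ϖ : ℝ) * W.realPeriodRat = plusPeriod f →
      IsSprungPair f p (W.frobeniusTrace p) Lsharp Lflat →
    ∀ (I : Kato2004.IwasawaH1Data W p κ γ)
      (Cs : SharpFlatColemanKatoDataContra W p f ϖ κ γ (closureEmb (K := ℚ) (v.adicCompletion ℚ))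
        (W.frobeniusTrace p) g c Chroma.sharp I)
      (Cf : SharpFlatColemanKatoDataContra W p f ϖ κ γ (closureEmb (K := ℚ) (v.adicCompletion ℚ))
        (W.frobeniusTrace p) g c Chroma.flat I),
      Cs.Z = Cf.Z →
    ∀ (Y : W.FineSelmerDualData κ γ⁻¹) (𝔭 : PrimeSpectrum (IwasawaAlgebra p)), 𝔭.asIdeal.height = 1 →
      (p : IwasawaAlgebra p) ∉ 𝔭.asIdeal →
      (¬ ∃ n : ℕ, ((cyclotomicOmega p n).map (Int.castRingHom ℤ_[p]) : PowerSeries ℤ_[p]) ∈ 𝔭.asIdeal) →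
    ∀ (Gs Gf : IwasawaAlgebra p),
      iwasawaToPowerSeries p Gs = PowerSeries.C (ϖ : ℚ_[p]) * iwasawaToPowerSeries p (chromaticL Chroma.sharp Lsharp Lflat) →
      iwasawaToPowerSeries p Gf = PowerSeries.C (ϖ : ℚ_[p]) * iwasawaToPowerSeries p (chromaticL Chroma.flat Lsharp Lflat) →
      min (Module.lengthAt (IwasawaAlgebra p) (IwasawaAlgebra p ⧸ Ideal.span {Gs}) 𝔭)
          (Module.lengthAt (IwasawaAlgebra p) (IwasawaAlgebra p ⧸ Ideal.span {Gf}) 𝔭) ≤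
        Module.lengthAt (IwasawaAlgebra p) Y.X 𝔭 +
          Module.lengthAt (IwasawaAlgebra p) (I.H ⧸ Cs.Z) (PrimeSpectrum.comap (invol p).toRingHom 𝔭) := by
  intro W _ _ p _ _ _ _ hX κ γ hκ hγ hcv v hv g hg cneg c hH N hN f ϖ Lsharp Lflat hf hϖ hSP I Cs Cf hZ Y 𝔭 h𝔭 hp𝔭
    hspor Gs Gf hGs hGf
  haveI : NeZero N := hN
  obtain ⟨hs0, hf0⟩ :=
    ChromaticBothColours.ClassX8.sharp_ne_zero_and_flat_ne_zero W p hX N inferInstance f Lsharp Lflat hf hSP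
  have hT : (PowerSeries.X : IwasawaAlgebra p) ∉ 𝔭.asIdeal := fun hT =>
    hspor ⟨0, by rwa [coe_map_cyclotomicOmega_zero]⟩
  obtain ⟨h𝔮, hp𝔮⟩ := comap_invol_heightOne_not_mem 𝔭 h𝔭 hp𝔭
  have hT𝔮 := X_not_mem_comap_invol 𝔭 hT
  refine min_lengthAt_quotient_span_le_fine_add_zeta_comap_invol_contra W p Cs Cf hZ (ClassX8.irr' W p hX)
    (hf.periodRatio_ne_zero hϖ) hSP hs0 hf0 hGs hGf (ClassX8.invol_mem_span_pair W p hX f Lsharp Lflat hf hSP) Y 𝔭 h𝔭 hp𝔭 ?_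
  intro hcommon𝔮
  have h := cokerBoundIotaOffT_contra_of_poitouTate_of_thm714' hPT hMatar h714 W p hX κ γ hκ hγ hcv v hv g hg cneg c hH N
    hN f ϖ Lsharp Lflat hf hϖ hSP I Cs Cf hZ Y (PrimeSpectrum.comap (invol p).toRingHom 𝔭) h𝔮 hp𝔮 hT𝔮 hcommon𝔮
  rwa [Kato2004.comap_invol_comap_invol] at h

end Summit.BirchSwinnertonDyer.BirchSwinnertonDyer.Theorems.ChromaticCommonZeros

end
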